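import Summits.ABC.ABC.Theses.CubicResolventAllowance
import Literature.Barriers.ABC.SzpiroEpsilonCannotBeDroppedProofs
import HarnessLib

/-!
# stub-ideation k2 (RESHAPE) — generation 8 sketch for `stub_complexCubic` (crux `IndexSzpiro`, stmt-ABC-22740)

Companion to `STUB-IDEAS-stub_complexCubic-2.md` (gen 8).  Gen 7 (`StubIdeas2G7Sketch.lean`, same directory,
carried BY REFERENCE: node lemma `NL_*`, the complex twin family `F1–F7`, `not_stubEpsZero`) showed that on the
orbit family `W_j` (below) the stub FAILS at `ε = 0`: `2^{6j+3} N_j⁶ ≤ 3²¹ |Δ_min(W_j)|`.  The natural next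
question — *is `(W_j)` a counterexample to the stub itself?* — is what gen 8 reshapes:

* §Z  **ORBIT PAYMENT** (regime split "fixed-prime tower / moving powerful part" + induction along the orbit).
  The only tower of `W_j` whose depth grows with `j` sits at the FIXED prime `2` (depth `6j + 9`); every odd
  prime enters the orbit denominators at one level and its depth is FROZEN from then on (formal group:
  `ord_p x(2P) = ord_p x(P)` for `p` odd).  Each level contributes a NEW prime `p_i ≥ 5` (a mod-9 computation on
  the orbit invariants — no Siegel, no height theory), the `p_i` are pairwise distinct and all divide `N_j`, so
  `N_j ≥ j!` and hence `∀ ε > 0 ∃ C ∀ j, 2^{6j} ≤ C · N_j^ε` (`Z_twoTowerPaid`, KERNEL-CHECKED from the helper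
  lemmas Z1–Z5): the deep 2-tower that kills `ε = 0` is paid by `N^ε` for every `ε > 0`.
* §S  **THE RESIDUAL IS PURE EDS ARITHMETIC.**  `StubFam` (the stub on the family) `↔ SQF` given §Z
  (`stubFam_iff_SQF`, KERNEL-CHECKED), where `SQF` says the squarefull excess of the odd part
  `w'_j = ∏_{i ≤ j} C'_i` (pairwise-coprime primitive parts of the numerators of `y(2^i Q₀)`) is `N_j^{o(1)}`.
  `SQF` is abc-strength for elliptic divisibility sequences (Silverman 1988; arXiv:2606.00466 §7.3 Lemma 25 is
  conditional on abc even for "some primitive divisor occurs to the first power") — OPEN, named, not attacked.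

`lean check --json`: rc 0, **2 sorries** — `Z0_orbit` (M; = gen-7 `F1_orbit`, template `BennettYazdani.orbit`) and
`stubFam_of_stub` (S; gen-7 F5/F6 glue).  Everything else — Z1a/Z1 (new prime per level), Z2a/Z2b/Z2 (entry, freeze),
Z3a/Z3b/Z3c/Z3 (denominator primes are multiplicative conductor primes), Z4, `factorial_le_conductorNorm`
(`j! ≤ N(W_j)`), Z5, `Z_twoTowerPaid`, `stubFam_iff_SQF`, `stub_footprint_on_family` — is KERNEL-CHECKED.
-/

open Polynomial
open IsDedekindDomain WeierstrassCurve Rat.HeightOneSpectrum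
open scoped NumberField Nat

set_option linter.dupNamespace false

namespace Summit.ABC.ABC.Cruxes.IndexSzpiro.StubIdeas2G8

open Summit.ABC.ABC.Theses.CubicResolventAllowance (IndexSzpiro)
open Literature.Barriers.ABC.BennettYazdani (c₄_mk Δ_mk isElliptic_mk padicValRat_add_intCast_of_neg
  not_dvd_num_den_of_padicValRat_eq_zero padicValRat_sub_one_eq)

/-! ## §0  The stub (verbatim) -/

/-- `stub_complexCubic`, verbatim. -/
def Stub : Prop :=
  ∀ ε : ℝ, 0 < ε → ∃ C : ℝ, ∀ (W : WeierstrassCurve ℚ) [W.IsElliptic] (K : Type) [Field K] [NumberField K],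
    Irreducible W.twoTorsionPolynomial.toPoly → Module.finrank ℚ K = 3 →
    (∃ θ : K, aeval θ W.twoTorsionPolynomial.toPoly = 0) → NumberField.discr K < 0 →
    (W.minimalDiscriminantNorm ℤ : ℝ) ≤ C * |(NumberField.discr K : ℝ)| * (W.conductorNorm ℤ : ℝ) ^ (6 + ε)

/-- (VERIFIED, trivial) the crux gives the stub by forgetting the sign. -/
theorem stub_of_indexSzpiro (h : IndexSzpiro) : Stub := by
  intro ε hε
  obtain ⟨C, hC⟩ := h ε hε
  exact ⟨C, fun W _ K _ _ hirr h3 hθ _ => hC W K hirr h3 hθ⟩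

/-! ## §Z  The orbit family and ORBIT PAYMENT -/

/-- `x`-coordinate duplication on `E₀ : Y² = X³ + 5832` (`5832 = 18³`). -/
def dbl (X : ℚ) : ℚ := (X ^ 4 - 46656 * X) / (4 * (X ^ 3 + 5832))

/-- The orbit `X_j = x(2^j Q₀)`, `Q₀ = (−63/4, 351/8)`. -/
def Xorb (j : ℕ) : ℚ := dbl^[j] (-63 / 4)

theorem Xorb_zero : Xorb 0 = -63 / 4 := rfl

theorem Xorb_succ (j : ℕ) : Xorb (j + 1) = dbl (Xorb j) := by
  rw [Xorb, Function.iterate_succ_apply']; rfl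

/-- `λ_j = 1 − 54/(X_j + 18)` (`= −x(T + 2^jQ₀)/18`, `T = (−18, 0)`). -/
def lam (j : ℕ) : ℚ := 1 - 54 / (Xorb j + 18)

/-- `λ_j = a_j / n_j` in lowest terms, `n_j > 0`. -/
def afam (j : ℕ) : ℤ := (lam j).num

/-- see `afam`. -/
def nfam (j : ℕ) : ℤ := (lam j).den

/-- The Hesse-type model `W(a,n) : y² + 3a·xy + (a³ − n³)·y = x³` (gen 7). -/
abbrev hesseModel (a n : ℤ) : WeierstrassCurve ℤ := WeierstrassCurve.mk (3 * a) 0 (a ^ 3 - n ^ 3) 0 0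

/-- THE FAMILY `W_j := W(a_j, n_j) ⊗ ℚ` as an honest function of `j` (gen 7 had it existentially). -/
def Wfam (j : ℕ) : WeierstrassCurve ℚ := (hesseModel (afam j) (nfam j)).baseChange ℚ

/-- (VERIFIED) `Δ(W(a,n)) = 27 n³ (a³ − n³)³`. -/
theorem hesse_Δ (a n : ℤ) : (hesseModel a n).Δ = 27 * n ^ 3 * (a ^ 3 - n ^ 3) ^ 3 := by
  rw [hesseModel, Δ_mk]; ring

/-- (VERIFIED) `c₄(W(a,n)) = 9a(a³ + 8n³)`. -/
theorem hesse_c₄ (a n : ℤ) : (hesseModel a n).c₄ = 9 * a * (a ^ 3 + 8 * n ^ 3) := by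
  rw [hesseModel, c₄_mk]; ring

/-- **Z0 (M, = gen-7 F1 `F1_orbit`, template `BennettYazdani.orbit`).**  Orbit invariants: the points stay on
`E₀`, `ord₂ X_j = −2 − 2j`, `ord₃ X_j = 2`, `ord₃ (X_j − 18) ≥ 3`. -/
theorem Z0_orbit (j : ℕ) :
    (∃ Y : ℚ, Y ^ 2 = Xorb j ^ 3 + 5832) ∧ padicValRat 2 (Xorb j) = -2 - 2 * j ∧
      padicValRat 3 (Xorb j) = 2 ∧ 3 ≤ padicValRat 3 (Xorb j - 18) := by
  sorry

/-- **Z0' (S from Z0).** `W_j` is an elliptic curve: `n_j ≠ 0` (a denominator) and `a_j ≠ n_j` because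
`λ_j ≠ 1`, i.e. `X_j ≠ −18` (`ord₂ X_j < 0 ≤ ord₂ (−18)`). -/
theorem Wfam_isElliptic (j : ℕ) : (Wfam j).IsElliptic := by
  haveI := Fact.mk Nat.prime_two
  have h2 := (Z0_orbit j).2.1
  have hneg : padicValRat 2 (Xorb j) < 0 := by rw [h2]; omega
  have h18 : padicValRat 2 (Xorb j + 18) = padicValRat 2 (Xorb j) := by
    have := padicValRat_add_intCast_of_neg hneg 18; push_cast at this; exact this
  have h18ne : Xorb j + 18 ≠ 0 := by intro h; rw [h] at h18; simp at h18; linarith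
  have hlam1 : lam j ≠ 1 := by
    intro h
    rw [lam] at h
    have h0 : (54 : ℚ) / (Xorb j + 18) = 0 := by linarith
    rcases div_eq_zero_iff.mp h0 with h' | h'
    · norm_num at h'
    · exact h18ne h'
  have hn0 : nfam j ≠ 0 := by rw [nfam]; exact_mod_cast (lam j).den_pos.ne'
  have han : afam j ≠ nfam j := by
    intro h
    apply hlam1
    have hq : ((lam j).num : ℚ) = ((lam j).den : ℚ) := by
      rw [afam, nfam] at h; exact_mod_cast h
    rw [← Rat.num_div_den (lam j), hq]
    exact div_self (by exact_mod_cast (lam j).den_pos.ne')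
  rw [Wfam]
  refine isElliptic_mk (sub_ne_zero.mpr fun h => han ?_) ?_
  · exact (Odd.strictMono_pow (R := ℤ) (by decide : Odd 3)).injective h
  · rw [show (3 * afam j) ^ 3 - 27 * (afam j ^ 3 - nfam j ^ 3) = 27 * nfam j ^ 3 by ring]
    exact mul_ne_zero (by norm_num) (pow_ne_zero 3 hn0)

/-- (VERIFIED) a prime `p ≥ 5` divides no `2^a 3^b`. -/
theorem not_dvd_two_pow_mul_three_pow {p : ℕ} (hp : p.Prime) (h5 : 5 ≤ p) (a b : ℕ) :
    ¬ p ∣ 2 ^ a * 3 ^ b := by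
  intro h
  rcases (Nat.Prime.dvd_mul hp).mp h with h | h
  · have := Nat.le_of_dvd (by norm_num) (Nat.Prime.dvd_of_dvd_pow hp h); omega
  · have := Nat.le_of_dvd (by norm_num) (Nat.Prime.dvd_of_dvd_pow hp h); omega

/-- (VERIFIED) `ord_p n = 0` for `p ∤ n`. -/
theorem padicValRat_natCast_eq_zero {p : ℕ} (n : ℕ) (h : ¬ p ∣ n) : padicValRat p (n : ℚ) = 0 := by
  rw [← padicValRat_of_nat]; exact_mod_cast padicValNat.eq_zero_of_not_dvd h

/-- (VERIFIED) `ord_p 5832 = ord_p 52488 = ord_p 54 = ord_p 4 = 0` for `p ≥ 5` (`2³3⁶, 2³3⁸, 2·3³, 2²`). -/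
theorem padicValRat_consts {p : ℕ} (hp : p.Prime) (h5 : 5 ≤ p) :
    padicValRat p (5832 : ℚ) = 0 ∧ padicValRat p (52488 : ℚ) = 0 ∧ padicValRat p (54 : ℚ) = 0 ∧
      padicValRat p (4 : ℚ) = 0 := by
  refine ⟨?_, ?_, ?_, ?_⟩
  · rw [show (5832 : ℚ) = ((5832 : ℕ) : ℚ) by norm_num]
    exact padicValRat_natCast_eq_zero _ (by
      rw [show (5832 : ℕ) = 2 ^ 3 * 3 ^ 6 by norm_num]; exact not_dvd_two_pow_mul_three_pow hp h5 3 6)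
  · rw [show (52488 : ℚ) = ((52488 : ℕ) : ℚ) by norm_num]
    exact padicValRat_natCast_eq_zero _ (by
      rw [show (52488 : ℕ) = 2 ^ 3 * 3 ^ 8 by norm_num]; exact not_dvd_two_pow_mul_three_pow hp h5 3 8)
  · rw [show (54 : ℚ) = ((54 : ℕ) : ℚ) by norm_num]
    exact padicValRat_natCast_eq_zero _ (by
      rw [show (54 : ℕ) = 2 ^ 1 * 3 ^ 3 by norm_num]; exact not_dvd_two_pow_mul_three_pow hp h5 1 3)
  · rw [show (4 : ℚ) = ((4 : ℕ) : ℚ) by norm_num]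
    exact padicValRat_natCast_eq_zero _ (by
      rw [show (4 : ℕ) = 2 ^ 2 * 3 ^ 0 by norm_num]; exact not_dvd_two_pow_mul_three_pow hp h5 2 0)

/-- `p` ENTERS the orbit denominators at level `i + 1`: `X_i` is `p`-integral and `p ∣ X_i³ + 18³`
(i.e. `p` divides the numerator `C_i` of `y(2^i Q₀)`; then `x(2^{i+1}Q₀)` has `p` in its denominator). -/
def EntersAt (p i : ℕ) : Prop := 0 ≤ padicValRat p (Xorb i) ∧ 0 < padicValRat p (Xorb i ^ 3 + 5832)

/-- **Z1 (S given Z0) — A NEW PRIME AT EVERY LEVEL, by a mod-9 computation.**  Write `X_i = A/D` in lowest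
terms; Z0 gives `A` odd... precisely `2 ∣ D`, `2 ∤ A`, `9 ∥ A`, `3 ∤ D`, `A/9 ≡ 2D (mod 3)`.  Then
`A³ + 5832 D³ = 3⁶ · m` with `m = (A/9)³ + 8D³ ≡ 16 D³ ≡ ±7 (mod 9)` and `m` odd, so `|m| ≥ 2`, `gcd(m, 6) = 1`,
and any prime `p ∣ m` is `≥ 5`, prime to `D` (as `p ∤ A`), with `ord_p (X_i³ + 5832) = ord_p m > 0`.
No Siegel / canonical height / Zsigmondy theorem is used. -/
private theorem zmod9_key : ∀ d k : ZMod 9, 3 * d ≠ 0 →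
    (2 * d + 3 * k) ^ 3 + 8 * d ^ 3 = 2 ∨ (2 * d + 3 * k) ^ 3 + 8 * d ^ 3 = 7 := by decide

private theorem zmod9_not_three_mul : ∀ t : ZMod 9, 3 * t ≠ 2 ∧ 3 * t ≠ 7 := by decide

/-- **Z1a (VERIFIED) — the integer heart of Z1.**  `X = A/D` reduced, `A` odd, `9 ∣ A`, `3 ∤ D`, `27 ∣ A − 18D`
⇒ `A³ + 18³D³ = 3⁶·m`, `m ≡ ±7 (mod 9)` odd, so some prime `p ≥ 5` divides `A³ + 18³D³` and not `D`. -/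
theorem Z1a_newPrime_int {A : ℤ} {D : ℕ} (hAD : A.natAbs.Coprime D) (hA : Odd A) (h9 : (9 : ℤ) ∣ A)
    (h3D : ¬ 3 ∣ D) (h27 : (27 : ℤ) ∣ A - 18 * D) :
    A ^ 3 + 5832 * (D : ℤ) ^ 3 ≠ 0 ∧
      ∃ p : ℕ, p.Prime ∧ 5 ≤ p ∧ (p : ℤ) ∣ A ^ 3 + 5832 * (D : ℤ) ^ 3 ∧ ¬ p ∣ D := by
  obtain ⟨A', rfl⟩ := h9
  have h3 : (3 : ℤ) ∣ A' - 2 * D := by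
    rw [show (27 : ℤ) = 9 * 3 by norm_num, show (9 : ℤ) * A' - 18 * D = 9 * (A' - 2 * D) by ring] at h27
    exact (mul_dvd_mul_iff_left (by norm_num : (9 : ℤ) ≠ 0)).mp h27
  obtain ⟨k, hk⟩ := h3
  set m : ℤ := A' ^ 3 + 8 * (D : ℤ) ^ 3 with hm
  have hN : (9 * A') ^ 3 + 5832 * (D : ℤ) ^ 3 = 729 * m := by rw [hm]; ring
  have hD9 : (3 : ZMod 9) * ((D : ℤ) : ZMod 9) ≠ 0 := by
    intro h
    apply h3D
    have h' : (((3 * (D : ℤ) : ℤ)) : ZMod 9) = 0 := by push_cast; exact h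
    rw [ZMod.intCast_zmod_eq_zero_iff_dvd] at h'
    have h'' : (9 : ℤ) ∣ 3 * (D : ℤ) := by exact_mod_cast h'
    omega
  have hA' : ((A' : ℤ) : ZMod 9) = 2 * ((D : ℤ) : ZMod 9) + 3 * ((k : ℤ) : ZMod 9) := by
    rw [show A' = 2 * D + 3 * k by linarith]; push_cast; ring
  have hm9 : ((m : ℤ) : ZMod 9) = 2 ∨ ((m : ℤ) : ZMod 9) = 7 := by
    rw [hm]; push_cast; rw [hA']
    exact zmod9_key _ _ hD9
  have hm0 : m ≠ 0 := by
    intro h0; rw [h0] at hm9; push_cast at hm9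
    rcases hm9 with h | h
    · exact absurd h (by decide)
    · exact absurd h (by decide)
  have hm1 : m.natAbs ≠ 1 := by
    intro h1
    have h' : m = 1 ∨ m = -1 := by omega
    rcases h' with h | h
    · rw [h] at hm9; push_cast at hm9
      rcases hm9 with h' | h'
      · exact absurd h' (by decide)
      · exact absurd h' (by decide)
    · rw [h] at hm9; push_cast at hm9
      rcases hm9 with h' | h'
      · exact absurd h' (by decide)
      · exact absurd h' (by decide)
  have hA'odd : Odd A' := (Int.odd_mul.mp hA).2
  have hm_odd : Odd m := by
    obtain ⟨t, ht⟩ := hA'odd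
    exact ⟨4 * t ^ 3 + 6 * t ^ 2 + 3 * t + 4 * (D : ℤ) ^ 3, by rw [hm, ht]; ring⟩
  have hm3 : ¬ (3 : ℤ) ∣ m := by
    rintro ⟨t, ht⟩
    have h' : ((m : ℤ) : ZMod 9) = 3 * ((t : ℤ) : ZMod 9) := by rw [ht]; push_cast; ring
    rw [h'] at hm9
    rcases hm9 with h | h
    · exact (zmod9_not_three_mul _).1 h
    · exact (zmod9_not_three_mul _).2 h
  refine ⟨by rw [hN]; exact mul_ne_zero (by norm_num) hm0, ?_⟩
  obtain ⟨p, hp, hpm⟩ := Nat.exists_prime_and_dvd hm1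
  have hpm' : (p : ℤ) ∣ m := Int.natCast_dvd.mpr hpm
  have hp2 : p ≠ 2 := by
    rintro rfl
    obtain ⟨t, ht⟩ := hm_odd
    obtain ⟨s, hs⟩ := hpm'
    omega
  have hp3 : p ≠ 3 := by
    rintro rfl
    exact hm3 (by exact_mod_cast hpm')
  have h5 : 5 ≤ p := by
    by_contra hlt
    push Not at hlt
    have h2 := hp.two_le
    interval_cases p
    · exact hp2 rfl
    · exact hp3 rfl
    · exact absurd hp (by decide)
  refine ⟨p, hp, h5, by rw [hN]; exact Dvd.dvd.mul_left hpm' 729, fun hpD => ?_⟩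
  have hpD' : (p : ℤ) ∣ 5832 * (D : ℤ) ^ 3 :=
    Dvd.dvd.mul_left (dvd_pow (Int.natCast_dvd_natCast.mpr hpD) three_ne_zero) _
  have hpN : (p : ℤ) ∣ (9 * A') ^ 3 + 5832 * (D : ℤ) ^ 3 := by rw [hN]; exact Dvd.dvd.mul_left hpm' 729
  have hpA3 : (p : ℤ) ∣ (9 * A') ^ 3 := by
    have := dvd_sub hpN hpD'
    rwa [add_sub_cancel_right] at this
  have hpA : (p : ℤ) ∣ 9 * A' := (Nat.prime_iff_prime_int.mp hp).dvd_of_dvd_pow hpA3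
  have h1 : p ∣ (9 * A').natAbs := Int.natCast_dvd.mp hpA
  exact hp.ne_one (Nat.eq_one_of_dvd_coprimes hAD h1 hpD)

theorem Z1_newPrime (i : ℕ) : ∃ p : ℕ, p.Prime ∧ 5 ≤ p ∧ EntersAt p i := by
  obtain ⟨-, h2, h3, h27⟩ := Z0_orbit i
  set X := Xorb i with hXdef
  haveI h2f := Fact.mk Nat.prime_two
  haveI h3f := Fact.mk Nat.prime_three
  have hAD : X.num.natAbs.Coprime X.den := X.reduced
  have hD0 : (X.den : ℚ) ≠ 0 := by exact_mod_cast X.den_pos.ne'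
  -- `A` is odd (`2 ∣ D` from `ord₂ X < 0`)
  have h2D : 2 ∣ X.den := by
    have hv : padicValRat 2 X < 0 := by rw [h2]; omega
    rw [padicValRat_def] at hv
    have h1 : 1 ≤ padicValNat 2 X.den := by
      by_contra h
      have h0 : padicValNat 2 X.den = 0 := by omega
      rw [h0] at hv
      omega
    exact dvd_of_one_le_padicValNat h1
  have hAodd : Odd X.num := by
    have h2A : ¬ (2 : ℤ) ∣ X.num := fun h2A =>
      absurd (Nat.eq_one_of_dvd_coprimes hAD (Int.natCast_dvd.mp (by exact_mod_cast h2A)) h2D)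
        (by norm_num)
    rcases Int.even_or_odd X.num with h | h
    · exact absurd (even_iff_two_dvd.mp h) h2A
    · exact h
  -- `3 ∤ D`, `9 ∣ A` (`ord₃ X = 2`)
  have h3v := h3
  rw [padicValRat_def] at h3v
  have h3D : ¬ 3 ∣ X.den := by
    intro h3D
    have h3A : ¬ (3 : ℤ) ∣ X.num := by
      intro h3A
      have h1 : 3 ∣ X.num.natAbs := Int.natCast_dvd.mp (by exact_mod_cast h3A)
      exact absurd (Nat.eq_one_of_dvd_coprimes hAD h1 h3D) (by norm_num)
    rw [padicValInt.eq_zero_of_not_dvd h3A] at h3v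
    simp at h3v
    omega
  have h3D0 : padicValNat 3 X.den = 0 := padicValNat.eq_zero_of_not_dvd h3D
  have h9 : (9 : ℤ) ∣ X.num := by
    rw [h3D0] at h3v
    have hvA : padicValInt 3 X.num = 2 := by omega
    have := padicValInt_dvd (p := 3) X.num
    rw [hvA] at this
    norm_num at this
    exact this
  -- `27 ∣ A − 18 D` (`ord₃ (X − 18) ≥ 3`)
  have h27' : (27 : ℤ) ∣ X.num - 18 * X.den := by
    by_cases h0 : X.num - 18 * (X.den : ℤ) = 0
    · rw [h0]; exact dvd_zero _
    have hX18 : X - 18 = ((X.num - 18 * X.den : ℤ) : ℚ) / (X.den : ℚ) := by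
      conv_lhs => rw [← Rat.num_div_den X]
      push_cast
      field_simp
    have hv : 3 ≤ padicValRat 3 (X - 18) := h27
    rw [hX18, padicValRat.div (by exact_mod_cast h0) hD0, padicValRat.of_int, padicValRat.of_nat,
      h3D0] at hv
    have h3le : 3 ≤ padicValInt 3 (X.num - 18 * X.den) := by
      have : (3 : ℤ) ≤ (padicValInt 3 (X.num - 18 * X.den) : ℤ) := by simpa using hv
      exact_mod_cast this
    have := (padicValInt_dvd_iff 3 (X.num - 18 * X.den)).mpr (Or.inr h3le)
    norm_num at this
    exact this
  obtain ⟨hN0, p, hp, h5, hpN, hpD⟩ := Z1a_newPrime_int hAD hAodd h9 h3D h27'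
  haveI := Fact.mk hp
  refine ⟨p, hp, h5, ?_, ?_⟩
  · rw [padicValRat_def, padicValNat.eq_zero_of_not_dvd hpD]; simp
  · have hX3 : X ^ 3 + 5832 = ((X.num ^ 3 + 5832 * (X.den : ℤ) ^ 3 : ℤ) : ℚ) / ((X.den : ℚ) ^ 3) := by
      conv_lhs => rw [← Rat.num_div_den X]
      push_cast
      field_simp
    rw [hX3, padicValRat.div (by exact_mod_cast hN0) (pow_ne_zero 3 hD0), padicValRat.pow,
      padicValRat.of_int, padicValRat.of_nat, padicValNat.eq_zero_of_not_dvd hpD]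
    have h1 : 1 ≤ padicValInt p (X.num ^ 3 + 5832 * (X.den : ℤ) ^ 3) := by
      rcases (padicValInt_dvd_iff 1 (X.num ^ 3 + 5832 * (X.den : ℤ) ^ 3)).mp (by simpa using hpN)
        with h | h
      · exact absurd h hN0
      · exact h
    have h1' : (1 : ℤ) ≤ (padicValInt p (X.num ^ 3 + 5832 * (X.den : ℤ) ^ 3) : ℤ) := by
      exact_mod_cast h1
    push_cast
    linarith

/-- **Z2a (S) — ENTRY.**  If `p ≥ 5` enters at level `i + 1` then `ord_p X_{i+1} = −ord_p (X_i³ + 5832) < 0`: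
in `dbl`, `ord_p X_i = 0` and `ord_p (X_i³ − 46656) = ord_p ((X_i³ + 5832) − 2³3⁸) = 0`. -/
theorem Z2a_entry {p i : ℕ} (hp : p.Prime) (h5 : 5 ≤ p) (h : EntersAt p i) :
    padicValRat p (Xorb (i + 1)) < 0 := by
  haveI := Fact.mk hp
  obtain ⟨h5832, h52488, -, h4v⟩ := padicValRat_consts hp h5
  obtain ⟨hint, hpos⟩ := h
  rw [Xorb_succ]
  set X := Xorb i with hXdef
  have hB0 : X ^ 3 + 5832 ≠ 0 := by intro h0; rw [h0] at hpos; simp at hpos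
  have hX0 : X ≠ 0 := by
    intro h0; rw [h0] at hpos; norm_num at hpos; rw [h5832] at hpos; exact lt_irrefl _ hpos
  have hA0 : X ^ 3 - 46656 ≠ 0 := by
    intro h0
    have h' : X ^ 3 + 5832 = 52488 := by linarith
    rw [h'] at hpos; rw [h52488] at hpos; exact lt_irrefl _ hpos
  have hv0 : padicValRat p X = 0 := by
    by_contra hne
    have hpos' : 0 < padicValRat p X := lt_of_le_of_ne hint (Ne.symm hne)
    have h3 : padicValRat p (5832 : ℚ) < padicValRat p (X ^ 3) := by
      rw [padicValRat.pow, h5832]; push_cast; linarith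
    have := padicValRat.add_eq_of_lt (p := p) (by rw [add_comm]; exact hB0) (by norm_num)
      (pow_ne_zero 3 hX0) h3
    rw [add_comm, h5832] at this
    rw [this] at hpos; exact lt_irrefl _ hpos
  have hA : padicValRat p (X ^ 3 - 46656) = 0 := by
    have heq : X ^ 3 - 46656 = -52488 + (X ^ 3 + 5832) := by ring
    have hlt : padicValRat p (-52488 : ℚ) < padicValRat p (X ^ 3 + 5832) := by
      rw [padicValRat.neg, h52488]; exact hpos
    rw [heq, padicValRat.add_eq_of_lt (p := p) (by rw [← heq]; exact hA0) (by norm_num) hB0 hlt,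
      padicValRat.neg, h52488]
  have h4 : (4 : ℚ) ≠ 0 := by norm_num
  rw [dbl, show X ^ 4 - 46656 * X = X * (X ^ 3 - 46656) by ring,
    padicValRat.div (mul_ne_zero hX0 hA0) (mul_ne_zero h4 hB0), padicValRat.mul hX0 hA0,
    padicValRat.mul h4 hB0, hv0, hA, h4v]
  linarith

/-- **Z2b (S, template `BennettYazdani.padicValRat_dbl`) — FREEZE** (the formal group at an odd prime):
`ord_p x(2P) = ord_p x(P)` once `ord_p x(P) < 0`. -/
theorem Z2b_freeze {p : ℕ} (hp : p.Prime) (hp2 : p ≠ 2) {X : ℚ} (hX : padicValRat p X < 0) :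
    padicValRat p (dbl X) = padicValRat p X := by
  haveI := Fact.mk hp
  have hX0 : X ≠ 0 := by rintro rfl; simp at hX
  have h3 : padicValRat p (X ^ 3) < 0 := by rw [padicValRat.pow]; push_cast; linarith
  have hA : padicValRat p (X ^ 3 - 46656) = padicValRat p (X ^ 3) := by
    have := padicValRat_add_intCast_of_neg h3 (-46656); push_cast at this
    rwa [← sub_eq_add_neg] at this
  have hB : padicValRat p (X ^ 3 + 5832) = padicValRat p (X ^ 3) := by
    have := padicValRat_add_intCast_of_neg h3 5832; push_cast at this; exact this
  have hA0 : X ^ 3 - 46656 ≠ 0 := by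
    intro h; rw [h] at hA; simp at hA; linarith
  have hB0 : X ^ 3 + 5832 ≠ 0 := by
    intro h; rw [h] at hB; simp at hB; linarith
  have h4 : (4 : ℚ) ≠ 0 := by norm_num
  have h4v : padicValRat p (4 : ℚ) = 0 := by
    rw [show (4 : ℚ) = ((4 : ℕ) : ℚ) by norm_num]
    refine padicValRat_natCast_eq_zero _ fun h => hp2 ?_
    exact (Nat.prime_dvd_prime_iff_eq hp Nat.prime_two).mp
      (Nat.Prime.dvd_of_dvd_pow hp (by rw [show (4 : ℕ) = 2 ^ 2 by norm_num] at h; exact h))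
  rw [dbl, show X ^ 4 - 46656 * X = X * (X ^ 3 - 46656) by ring,
    padicValRat.div (mul_ne_zero hX0 hA0) (mul_ne_zero h4 hB0), padicValRat.mul hX0 hA0,
    padicValRat.mul h4 hB0, hA, hB, h4v]
  ring

/-- **Z2 (VERIFIED from Z2a, Z2b).**  Once entered, a prime never leaves the denominators. -/
theorem Z2_frozen {p i : ℕ} (hp : p.Prime) (h5 : 5 ≤ p) (h : EntersAt p i) :
    ∀ k, i < k → padicValRat p (Xorb k) < 0 := by
  intro k hk
  induction k with
  | zero => omega
  | succ k ih =>
    rcases Nat.lt_succ_iff_lt_or_eq.mp hk with hlt | heq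
    · have hk' := ih hlt
      rw [Xorb_succ, Z2b_freeze hp (by omega) hk']
      exact hk'
    · subst heq
      exact Z2a_entry hp h5 h

/-- **(VERIFIED from Z2)** the entry level of a prime is unique, so distinct levels give DISTINCT primes. -/
theorem level_unique {p i i' : ℕ} (hp : p.Prime) (h5 : 5 ≤ p) (hi : EntersAt p i) (hi' : EntersAt p i') :
    i = i' := by
  by_contra hne
  rcases Nat.lt_or_gt_of_ne hne with h | h
  · exact absurd hi'.1 (not_le.mpr (Z2_frozen hp h5 hi i' h))
  · exact absurd hi.1 (not_le.mpr (Z2_frozen hp h5 hi' i h))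

/-- **Z3a (S, templates `BennettYazdani.padicValRat_lam_sub_one`, `not_dvd_num_den_of_padicValRat_eq_zero`,
`padicValRat_sub_one_eq`).**  A denominator prime `p ≥ 5` of `X_j` has `ord_p (λ_j − 1) = −ord_p (X_j + 18) > 0`,
so `p ∣ a_j − n_j` and `p ∤ n_j`. -/
theorem Z3a_dvd_sub {p j : ℕ} (hp : p.Prime) (h5 : 5 ≤ p) (hneg : padicValRat p (Xorb j) < 0) :
    (p : ℤ) ∣ afam j - nfam j ∧ ¬ (p : ℤ) ∣ nfam j := by
  haveI := Fact.mk hp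
  obtain ⟨-, -, h54, -⟩ := padicValRat_consts hp h5
  set X := Xorb j with hXdef
  have h18 : padicValRat p (X + 18) = padicValRat p X := by
    have := padicValRat_add_intCast_of_neg hneg 18; push_cast at this; exact this
  have h18ne : X + 18 ≠ 0 := by intro h; rw [h] at h18; simp at h18; linarith
  set q : ℚ := 54 / (X + 18) with hqdef
  have hq0 : q ≠ 0 := div_ne_zero (by norm_num) h18ne
  have hq : 0 < padicValRat p q := by
    rw [hqdef, padicValRat.div (by norm_num) h18ne, h54, h18]; linarith
  have hlam_eq : lam j = 1 + -q := by rw [lam, hqdef, sub_eq_add_neg]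
  have hsum0 : (1 : ℚ) + -q ≠ 0 := by
    intro h
    have h1 : q = 1 := by linarith
    rw [h1] at hq; simp at hq
  have hlam : padicValRat p (lam j) = 0 := by
    rw [hlam_eq, padicValRat.add_eq_of_lt (p := p) hsum0 one_ne_zero (neg_ne_zero.mpr hq0)
      (by rw [padicValRat.one, padicValRat.neg]; exact hq), padicValRat.one]
  have hlam0 : lam j ≠ 0 := by rw [hlam_eq]; exact hsum0
  obtain ⟨-, hden⟩ := not_dvd_num_den_of_padicValRat_eq_zero hlam0 hlam
  refine ⟨?_, hden⟩
  have hsub : padicValRat p (lam j - 1) = padicValInt p ((lam j).num - (lam j).den) :=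
    padicValRat_sub_one_eq hden
  have hpos : 0 < padicValRat p (lam j - 1) := by
    rw [hlam_eq, show (1 : ℚ) + -q - 1 = -q by ring, padicValRat.neg]; exact hq
  rw [hsub] at hpos
  have h1 : 1 ≤ padicValInt p (afam j - nfam j) := by
    rw [afam, nfam]; exact_mod_cast hpos
  have := (padicValInt_dvd_iff 1 (afam j - nfam j)).mpr (Or.inr h1)
  rwa [pow_one] at this

/-- **Z3b (VERIFIED).**  `p ∣ a − n`, `p ∤ n`, `p ≥ 5` ⇒ `p ∣ Δ(W(a,n)) = 27n³(a³−n³)³` and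
`p ∤ c₄(W(a,n)) = 9a(a³ + 8n³) ≡ 81 n⁴ (mod p)`: MULTIPLICATIVE reduction at `p`. -/
theorem Z3b_dvd_Δ_not_dvd_c₄ {p : ℕ} (hp : p.Prime) (h5 : 5 ≤ p) {a n : ℤ} (han : (p : ℤ) ∣ a - n)
    (hn : ¬ (p : ℤ) ∣ n) : (p : ℤ) ∣ (hesseModel a n).Δ ∧ ¬ (p : ℤ) ∣ (hesseModel a n).c₄ := by
  haveI := Fact.mk hp
  constructor
  · rw [hesse_Δ]
    have h3 : (p : ℤ) ∣ a ^ 3 - n ^ 3 := by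
      have : a ^ 3 - n ^ 3 = (a - n) * (a ^ 2 + a * n + n ^ 2) := by ring
      rw [this]; exact dvd_mul_of_dvd_left han _
    exact Dvd.dvd.mul_left (dvd_pow h3 three_ne_zero) _
  · rw [hesse_c₄]
    intro h
    have h1 : (((9 * a * (a ^ 3 + 8 * n ^ 3) : ℤ) : ZMod p)) = 0 :=
      (ZMod.intCast_zmod_eq_zero_iff_dvd _ p).mpr h
    have h2 : (((a - n : ℤ) : ZMod p)) = 0 := (ZMod.intCast_zmod_eq_zero_iff_dvd _ p).mpr han
    have hn' : ((n : ℤ) : ZMod p) ≠ 0 := fun h' => hn ((ZMod.intCast_zmod_eq_zero_iff_dvd _ p).mp h')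
    push_cast at h1 h2
    have ha : (a : ZMod p) = (n : ZMod p) := sub_eq_zero.mp h2
    rw [ha] at h1
    have h3 : (3 : ZMod p) ≠ 0 := by
      intro h3
      have h3' : (((3 : ℤ) : ZMod p)) = 0 := by exact_mod_cast h3
      have hd : (p : ℤ) ∣ 3 := (ZMod.intCast_zmod_eq_zero_iff_dvd _ p).mp h3'
      have hd' : p ∣ 3 := by exact_mod_cast hd
      have := Nat.le_of_dvd (by norm_num) hd'
      omega
    have h81 : (81 : ZMod p) ≠ 0 := by
      have : (81 : ZMod p) = 3 ^ 4 := by norm_num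
      rw [this]; exact pow_ne_zero _ h3
    have hrw : (9 * (n : ZMod p) * ((n : ZMod p) ^ 3 + 8 * (n : ZMod p) ^ 3)) = 81 * (n : ZMod p) ^ 4 := by
      ring
    rw [hrw] at h1
    rcases mul_eq_zero.mp h1 with h | h
    · exact h81 h
    · exact hn' (pow_eq_zero_iff (n := 4) (by norm_num) |>.mp h)

/-- **Z3c (VERIFIED, tree glue).**  For an integral equation: `p ∣ Δ`, `p ∤ c₄` ⇒ the equation is minimal at `p`
with multiplicative reduction, `f_p = 1`, hence `p ∣ N` (`isMinimalAt_baseChange_int_of_not_dvd_c₄`,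
`conductorExponent_eq_one_of_dvd_Δ_of_not_dvd_c₄`, `factorization_conductorNorm_primesEquiv_symm`). -/
theorem Z3c_dvd_conductorNorm (W₀ : WeierstrassCurve ℤ) [(W₀.baseChange ℚ).IsElliptic] {p : ℕ} (hp : p.Prime)
    (hΔ : (p : ℤ) ∣ W₀.Δ) (hc₄ : ¬ (p : ℤ) ∣ W₀.c₄) : p ∣ (W₀.baseChange ℚ).conductorNorm ℤ := by
  set v : HeightOneSpectrum ℤ := (primesEquiv (R := ℤ)).symm ⟨p, hp⟩ with hv
  have hgen : natGenerator v = p :=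
    Literature.NumberTheory.EllipticCurves.Rat.natGenerator_primesEquiv_symm ⟨p, hp⟩
  have hmin : (W₀.baseChange ℚ).IsMinimalAt v :=
    isMinimalAt_baseChange_int_of_not_dvd_c₄ (by rw [hgen]; exact hc₄)
  have hf : (W₀.baseChange ℚ).conductorExponent v = 1 :=
    conductorExponent_eq_one_of_dvd_Δ_of_not_dvd_c₄ hmin (by rw [hgen]; exact hΔ) (by rw [hgen]; exact hc₄)
  have hfac : ((W₀.baseChange ℚ).conductorNorm ℤ).factorization p = 1 := by
    have := factorization_conductorNorm_primesEquiv_symm (W₀.baseChange ℚ) ⟨p, hp⟩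
    rw [← hv, hf] at this
    exact this
  exact Nat.dvd_of_factorization_pos (by rw [hfac]; exact one_ne_zero)

/-- **Z3 (VERIFIED from Z3a–c).**  Every denominator prime `p ≥ 5` of `X_j` is a (multiplicative) conductor
prime of `W_j`. -/
theorem Z3_dvd_conductorNorm (j : ℕ) [(Wfam j).IsElliptic] {p : ℕ} (hp : p.Prime) (h5 : 5 ≤ p)
    (hneg : padicValRat p (Xorb j) < 0) : p ∣ (Wfam j).conductorNorm ℤ := by
  obtain ⟨han, hn⟩ := Z3a_dvd_sub hp h5 hneg
  obtain ⟨hΔ, hc₄⟩ := Z3b_dvd_Δ_not_dvd_c₄ hp h5 han hn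
  haveI : ((hesseModel (afam j) (nfam j)).baseChange ℚ).IsElliptic := ‹(Wfam j).IsElliptic›
  exact Z3c_dvd_conductorNorm (hesseModel (afam j) (nfam j)) hp hΔ hc₄

/-- **Z4 (VERIFIED, folklore; proof copied from the tree's private `factorial_card_le_prod`).**
`(#Q)! ≤ ∏ Q` for a finset `Q` of positive integers. -/
theorem factorial_card_le_prod (Q : Finset ℕ) (hQ : ∀ q ∈ Q, 1 ≤ q) : (Q.card)! ≤ ∏ q ∈ Q, q := by
  classical
  induction Q using Finset.induction_on_max with
  | empty => simp
  | insert a s hlt ih =>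
    have ha : a ∉ s := fun h => lt_irrefl a (hlt a h)
    have hs1 : ∀ q ∈ s, 1 ≤ q := fun q hq => hQ q (Finset.mem_insert_of_mem hq)
    have hcard : s.card + 1 ≤ a := by
      have hsub : s ⊆ Finset.Ico 1 a := fun q hq => Finset.mem_Ico.2 ⟨hs1 q hq, hlt q hq⟩
      have := Finset.card_le_card hsub
      rw [Nat.card_Ico] at this
      have h1a : 1 ≤ a := hQ a (Finset.mem_insert_self a s)
      omega
    rw [Finset.prod_insert ha, Finset.card_insert_of_notMem ha, Nat.factorial_succ]
    exact Nat.mul_le_mul hcard (ih hs1)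

/-- **(VERIFIED from Z1, Z2, Z3, Z4)**  SUPER-EXPONENTIAL CONDUCTOR GROWTH along the orbit: `j! ≤ N(W_j)`
(levels `0, …, j−1` contribute `j` distinct primes `≥ 5`, all dividing `N_j`). -/
theorem factorial_le_conductorNorm (j : ℕ) [(Wfam j).IsElliptic] : j ! ≤ (Wfam j).conductorNorm ℤ := by
  classical
  choose p hp h5 hE using Z1_newPrime
  set S : Finset ℕ := (Finset.range j).image p with hS
  have hinj : Set.InjOn p ↑(Finset.range j) := by
    intro i _ i' _ h
    have hEi' : EntersAt (p i) i' := by rw [h]; exact hE i'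
    exact level_unique (hp i) (h5 i) (hE i) hEi'
  have hcard : S.card = j := by
    rw [hS, Finset.card_image_of_injOn hinj, Finset.card_range]
  have hprime : ∀ q ∈ S, q.Prime := by
    intro q hq
    obtain ⟨i, _, rfl⟩ := Finset.mem_image.mp hq
    exact hp i
  have hdvd : ∀ q ∈ S, q ∣ (Wfam j).conductorNorm ℤ := by
    intro q hq
    obtain ⟨i, hi, rfl⟩ := Finset.mem_image.mp hq
    exact Z3_dvd_conductorNorm j (hp i) (h5 i) (Z2_frozen (hp i) (h5 i) (hE i) j (Finset.mem_range.mp hi))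
  have hprod : ∏ q ∈ S, q ∣ (Wfam j).conductorNorm ℤ :=
    Finset.prod_primes_dvd _ (fun q hq => (hprime q hq).prime) hdvd
  have hN : 0 < (Wfam j).conductorNorm ℤ := conductorNorm_pos_holds (Wfam j)
  calc j ! = (S.card)! := by rw [hcard]
    _ ≤ ∏ q ∈ S, q := factorial_card_le_prod S (fun q hq => (hprime q hq).one_le)
    _ ≤ (Wfam j).conductorNorm ℤ := Nat.le_of_dvd hN hprod

/-- `(c²)ʲ·(c²)! ≤ (c² + j)!` (folklore; copied from the tree). -/
private theorem sq_pow_mul_factorial_le (c : ℕ) : ∀ j : ℕ, (c ^ 2) ^ j * (c ^ 2)! ≤ (c ^ 2 + j)!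
  | 0 => by simp
  | j + 1 => by
    calc (c ^ 2) ^ (j + 1) * (c ^ 2)! = c ^ 2 * ((c ^ 2) ^ j * (c ^ 2)!) := by ring
      _ ≤ (c ^ 2 + j + 1) * (c ^ 2 + j)! := Nat.mul_le_mul (by omega) (sq_pow_mul_factorial_le c j)
      _ = (c ^ 2 + (j + 1))! := by rw [← add_assoc, ← Nat.factorial_succ]

/-- `cⁿ ≤ n!` for `n ≥ 2c²` (folklore; copied from the tree). -/
private theorem pow_le_factorial_of_two_mul_sq_le {c n : ℕ} (hn : 2 * c ^ 2 ≤ n) : c ^ n ≤ n ! := by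
  induction n, hn using Nat.le_induction with
  | base =>
    have h := sq_pow_mul_factorial_le c (c ^ 2)
    rw [← pow_mul, show c ^ 2 + c ^ 2 = 2 * c ^ 2 by ring] at h
    calc c ^ (2 * c ^ 2) = c ^ (2 * c ^ 2) * 1 := (mul_one _).symm
      _ ≤ c ^ (2 * c ^ 2) * (c ^ 2)! := Nat.mul_le_mul_left _ (Nat.factorial_pos _)
      _ ≤ (2 * c ^ 2)! := h
  | succ n hn ih =>
    have hc : c ≤ n + 1 := by nlinarith
    calc c ^ (n + 1) = c * c ^ n := by ring
      _ ≤ (n + 1) * n ! := Nat.mul_le_mul hc ih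
      _ = (n + 1)! := (Nat.factorial_succ n).symm

/-- **Z5 (S, elementary analysis).**  `2^{6j} ≤ C(ε) · (j!)^ε`: choose `c ∈ ℕ` with `c^ε ≥ 64`
(`c = ⌈64^{1/ε}⌉₊`); for `j ≥ 2c²`, `(j!)^ε ≥ (c^j)^ε ≥ 64^j` (`pow_le_factorial_of_two_mul_sq_le`); the
`j < 2c²` are covered by `C = 2^{12c²}`. -/
theorem Z5_two_pow_le_factorial_rpow (ε : ℝ) (hε : 0 < ε) :
    ∃ C : ℝ, 0 ≤ C ∧ ∀ j : ℕ, (2 : ℝ) ^ (6 * j) ≤ C * ((j ! : ℕ) : ℝ) ^ ε := by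
  obtain ⟨c, hc⟩ : ∃ c : ℕ, (64 : ℝ) ≤ (c : ℝ) ^ ε := by
    refine ⟨⌈(64 : ℝ) ^ (1 / ε)⌉₊, ?_⟩
    have h64 : (0 : ℝ) ≤ 64 := by norm_num
    have hle : (64 : ℝ) ^ (1 / ε) ≤ (⌈(64 : ℝ) ^ (1 / ε)⌉₊ : ℝ) := Nat.le_ceil _
    calc (64 : ℝ) = ((64 : ℝ) ^ (1 / ε)) ^ ε := by
          rw [← Real.rpow_mul h64, one_div_mul_cancel hε.ne', Real.rpow_one]
      _ ≤ (⌈(64 : ℝ) ^ (1 / ε)⌉₊ : ℝ) ^ ε := Real.rpow_le_rpow (Real.rpow_nonneg h64 _) hle hε.le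
  refine ⟨(2 : ℝ) ^ (6 * (2 * c ^ 2)), by positivity, fun j => ?_⟩
  have hfac1 : (1 : ℝ) ≤ ((j ! : ℕ) : ℝ) ^ ε :=
    Real.one_le_rpow (by exact_mod_cast Nat.one_le_of_lt (Nat.factorial_pos j)) hε.le
  rcases lt_or_ge j (2 * c ^ 2) with hj | hj
  · calc (2 : ℝ) ^ (6 * j) ≤ (2 : ℝ) ^ (6 * (2 * c ^ 2)) := pow_le_pow_right₀ (by norm_num) (by omega)
      _ = (2 : ℝ) ^ (6 * (2 * c ^ 2)) * 1 := (mul_one _).symm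
      _ ≤ (2 : ℝ) ^ (6 * (2 * c ^ 2)) * ((j ! : ℕ) : ℝ) ^ ε := by gcongr
  · have hcj : (c : ℝ) ^ j ≤ ((j ! : ℕ) : ℝ) := by exact_mod_cast pow_le_factorial_of_two_mul_sq_le hj
    have h1 : (1 : ℝ) ≤ (2 : ℝ) ^ (6 * (2 * c ^ 2)) := one_le_pow₀ (by norm_num)
    have hswap : ((c : ℝ) ^ ε) ^ j = ((c : ℝ) ^ j) ^ ε := by
      rw [← Real.rpow_natCast ((c : ℝ) ^ ε) j, ← Real.rpow_mul (Nat.cast_nonneg c), mul_comm,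
        Real.rpow_mul (Nat.cast_nonneg c), Real.rpow_natCast]
    calc (2 : ℝ) ^ (6 * j) = (64 : ℝ) ^ j := by rw [pow_mul]; norm_num
      _ ≤ ((c : ℝ) ^ ε) ^ j := by gcongr
      _ = ((c : ℝ) ^ j) ^ ε := hswap
      _ ≤ ((j ! : ℕ) : ℝ) ^ ε := Real.rpow_le_rpow (by positivity) hcj hε.le
      _ = 1 * ((j ! : ℕ) : ℝ) ^ ε := (one_mul _).symm
      _ ≤ (2 : ℝ) ^ (6 * (2 * c ^ 2)) * ((j ! : ℕ) : ℝ) ^ ε := by gcongr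

/-- **Z — ORBIT PAYMENT (VERIFIED from Z1–Z5).**  The deep 2-tower of the twin family (depth `6j + 9`, the
reason `ε = 0` fails, gen-7 `not_stubEpsZero`) is PAID by `N^ε` for every `ε > 0`. -/
theorem Z_twoTowerPaid (ε : ℝ) (hε : 0 < ε) :
    ∃ C : ℝ, 0 ≤ C ∧ ∀ (j : ℕ) [(Wfam j).IsElliptic], (2 : ℝ) ^ (6 * j) ≤ C * ((Wfam j).conductorNorm ℤ : ℝ) ^ ε := by
  obtain ⟨C, hC0, hC⟩ := Z5_two_pow_le_factorial_rpow ε hε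
  refine ⟨C, hC0, fun j _ => ?_⟩
  have hfac : ((j ! : ℕ) : ℝ) ≤ ((Wfam j).conductorNorm ℤ : ℝ) := by
    exact_mod_cast factorial_le_conductorNorm j
  calc (2 : ℝ) ^ (6 * j) ≤ C * ((j ! : ℕ) : ℝ) ^ ε := hC j
    _ ≤ C * ((Wfam j).conductorNorm ℤ : ℝ) ^ ε := by
        have := Real.rpow_le_rpow (Nat.cast_nonneg _) hfac hε.le
        gcongr

/-! ## §S  The stub on the family = a pure EDS statement -/

/-- THE STUB RESTRICTED TO THE FAMILY (the resolvent field of `W_j` is complex with `|d_K| ∣ 1944`, gen-7 F6, so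
the allowance is a bounded constant and is dropped). -/
def StubFam : Prop :=
  ∀ ε : ℝ, 0 < ε → ∃ C : ℝ, ∀ (j : ℕ) [(Wfam j).IsElliptic],
    ((Wfam j).minimalDiscriminantNorm ℤ : ℝ) ≤ C * ((Wfam j).conductorNorm ℤ : ℝ) ^ (6 + ε)

/-- **SQF — the named OPEN residual** (abc-strength for the elliptic divisibility sequence of `Q₀` on `E₀`):
after forgiving the 2-tower `2^{6j}`, Szpiro `6 + ε` holds on the family; equivalently (gen-7 F3d/F4a:
`|Δ_min(W_j)| = 2³3⁹ w_j⁶`, `w_j = 2^{j+1} w'_j`, `N_j = 2·3^{f₃}·rad w'_j`) the squarefull excess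
`(w'_j / rad w'_j)⁶` is `≤ C(ε) · rad(w'_j)^ε`, where `w'_j = ∏_{i ≤ j} C'_i` (pairwise coprime, depths frozen). -/
def SQF : Prop :=
  ∀ ε : ℝ, 0 < ε → ∃ C : ℝ, ∀ (j : ℕ) [(Wfam j).IsElliptic],
    ((Wfam j).minimalDiscriminantNorm ℤ : ℝ) ≤ C * (2 : ℝ) ^ (6 * j) * ((Wfam j).conductorNorm ℤ : ℝ) ^ (6 + ε)

/-- **(S given gen-7 F5 `F5_irreducible`, F6 `F6_resolvent_inert`, `exists_resolventField`)**: the family lies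
in the stub's class (irreducible `ψ₂`, complex resolvent field with `|d_K| ∣ 1944`), so the stub implies
`StubFam` (with `C ↦ 1944·C`). -/
theorem stubFam_of_stub (h : Stub) : StubFam := by
  sorry

/-- **(VERIFIED, from §Z)**  On the family the stub is EQUIVALENT to the pure EDS statement `SQF`:
`→` is trivial (`2^{6j} ≥ 1`); `←` splits `ε = ε/2 + ε/2` between `SQF` and `Z_twoTowerPaid`. -/
theorem stubFam_iff_SQF : StubFam ↔ SQF := by
  constructor
  · intro h ε hε
    obtain ⟨C, hC⟩ := h ε hε
    refine ⟨max C 0, fun j _ => ?_⟩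
    have hN : (0 : ℝ) ≤ ((Wfam j).conductorNorm ℤ : ℝ) ^ (6 + ε) :=
      Real.rpow_nonneg (Nat.cast_nonneg _) _
    have h2 : (1 : ℝ) ≤ (2 : ℝ) ^ (6 * j) := one_le_pow₀ (by norm_num)
    calc ((Wfam j).minimalDiscriminantNorm ℤ : ℝ) ≤ C * ((Wfam j).conductorNorm ℤ : ℝ) ^ (6 + ε) := hC j
      _ ≤ max C 0 * ((Wfam j).conductorNorm ℤ : ℝ) ^ (6 + ε) := by
          gcongr; exact le_max_left _ _
      _ = max C 0 * 1 * ((Wfam j).conductorNorm ℤ : ℝ) ^ (6 + ε) := by rw [mul_one]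
      _ ≤ max C 0 * (2 : ℝ) ^ (6 * j) * ((Wfam j).conductorNorm ℤ : ℝ) ^ (6 + ε) := by
          gcongr
  · intro h ε hε
    obtain ⟨C₁, hC₁⟩ := h (ε / 2) (by linarith)
    obtain ⟨C₂, hC₂0, hC₂⟩ := Z_twoTowerPaid (ε / 2) (by linarith)
    refine ⟨max C₁ 0 * C₂, fun j _ => ?_⟩
    have hNpos : (0 : ℝ) < ((Wfam j).conductorNorm ℤ : ℝ) := by
      exact_mod_cast conductorNorm_pos_holds (Wfam j)
    have hsplit : ((Wfam j).conductorNorm ℤ : ℝ) ^ (ε / 2) * ((Wfam j).conductorNorm ℤ : ℝ) ^ (6 + ε / 2) =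
        ((Wfam j).conductorNorm ℤ : ℝ) ^ (6 + ε) := by
      rw [← Real.rpow_add hNpos]; ring_nf
    have hN : (0 : ℝ) ≤ ((Wfam j).conductorNorm ℤ : ℝ) ^ (6 + ε / 2) :=
      Real.rpow_nonneg (Nat.cast_nonneg _) _
    calc ((Wfam j).minimalDiscriminantNorm ℤ : ℝ)
        ≤ C₁ * (2 : ℝ) ^ (6 * j) * ((Wfam j).conductorNorm ℤ : ℝ) ^ (6 + ε / 2) := hC₁ j
      _ ≤ max C₁ 0 * (2 : ℝ) ^ (6 * j) * ((Wfam j).conductorNorm ℤ : ℝ) ^ (6 + ε / 2) := by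
          gcongr; exact le_max_left _ _
      _ ≤ max C₁ 0 * (C₂ * ((Wfam j).conductorNorm ℤ : ℝ) ^ (ε / 2)) *
            ((Wfam j).conductorNorm ℤ : ℝ) ^ (6 + ε / 2) := by
          have := hC₂ j
          gcongr
      _ = max C₁ 0 * C₂ * (((Wfam j).conductorNorm ℤ : ℝ) ^ (ε / 2) *
            ((Wfam j).conductorNorm ℤ : ℝ) ^ (6 + ε / 2)) := by ring
      _ = max C₁ 0 * C₂ * ((Wfam j).conductorNorm ℤ : ℝ) ^ (6 + ε) := by rw [hsplit]

/-- (VERIFIED bookkeeping) what any proof of the stub must therefore prove about the EDS of `Q₀`, and what it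
need NOT prove (the 2-tower). -/
theorem stub_footprint_on_family (h : Stub) : SQF := stubFam_iff_SQF.mp (stubFam_of_stub h)

end Summit.ABC.ABC.Cruxes.IndexSzpiro.StubIdeas2G8
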